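import Literature.Topology.FourManifolds.SeamFunction
import Literature.Topology.FourManifolds.RegularInterval
import Literature.Topology.FourManifolds.FlowsProofs
import HarnessLib

/-!
# The seam tube of a gluing: a product neighbourhood `∂M × (-ε, ε)` of the seam

Third file of the proof of the tree's named fact
`Literature.Topology.FourManifolds.nonempty_diffeomorph_of_isBoundaryGluing` (`Gluing.lean`;
Hirsch (1976), Ch. 8, Thm. 2.1 / Thm. 1.9; Bröcker–Jänich (1982), (13.8)–(13.9)).

For gluing data `G : BoundaryGluingData bM bN φ P` of compact Hausdorff pieces we construct a
**seam tube** (`BoundaryGluingData.SeamTube`, existence `nonempty_seamTube`): a jointly `C^∞` map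
`K : ∂M × ℝ → P` with `K (x, 0) = jA (incl x)`, which restricts on `∂M × (-ε, ε)` to a
diffeomorphism onto the open neighbourhood `{|f| < ε}` of the seam (with `C^∞` inverse
`p ↦ (σ (θ_{-f p} p), f p)`), carrying `∂M × (0, ε)` into `jA (Int M)` and `∂M × (-ε, 0)` into
`jB (Int N)`, and whose height `f` is a seam height function of `SeamFunction.lean`:
`f (K (x, t)) = t`.  This is the tubular (product) neighbourhood `τ` of the seam `V` in Hirsch's
proof of the smoothing theorem 8.1.9, and the map `∂M × (-1, 1) → M ∪_φ N` of Bröcker–Jänich's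
(13.8) for the glued manifold `P`.

Construction (Milnor, *Morse theory* (1963), proof of Thm. 3.1; *Lectures on the h-cobordism
theorem* (1965), proof of Thm. 3.4): let `f` be a seam height function (`exists_seamFunction_iff`:
`f⁻¹(0)` is the seam and `0` a regular value), `ξ` a smooth vector field on `P` with `ξ(f) = 1`
on `f⁻¹[-δ, δ]` (`Literature.Topology.FourManifolds.exists_contMDiffSection_mlineDeriv_eq_one_slab`,
`RegularSlabField.lean`) and `θ` its global flow (`P` is compact without boundary;
`Literature.Topology.FourManifolds.exists_contMDiff_globalFlow_of_boundarylessManifold`,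
`FlowsProofs.lean`).  Then `K (x, t) = θ (t, jA (incl x))`; along flow lines `f` has unit
speed inside the slab (`Literature.Topology.FourManifolds.UnitSpeed`, `RegularInterval.lean`), so
`f (K (x, t)) = t` for `|t| < δ` and the backward flow `p ↦ θ (-f p, p)` retracts `{|f| < δ}`
onto the seam; smoothness of the inverse into `∂M` is tested through the immersions `incl`
and `jA` (`ContMDiffWithinAt.iff_comp_isImmersionAt`, `BoundaryGluingData.lean`).

Everything here is proved; no named facts are introduced.

## References

* M. W. Hirsch, *Differential Topology*, GTM 33 (1976), Ch. 8 §1, proof of Thm. 1.9; Ch. 6 §2.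
  [HirschDT1976]
* Th. Bröcker, K. Jänich, *Introduction to Differential Topology* (1982), (13.8). [BrockerJanich1982]
* J. Milnor, *Morse theory* (1963), Thm. 3.1; *Lectures on the h-cobordism theorem* (1965),
  proof of Thm. 3.4. [Milnor1963] [MilnorHCobordism1965]
-/

open scoped Manifold ContDiff Topology
open Set Function Metric Filter Topology

noncomputable section

namespace Literature.Topology.FourManifolds

universe u w

/-- Local notation: `𝔼 n` is the model Euclidean space `EuclideanSpace ℝ (Fin n)`. -/
local notation "𝔼 " n:arg => EuclideanSpace ℝ (Fin n)
/-- Local notation: `ℍ n` is the closed half space `EuclideanHalfSpace n`. -/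
local notation "ℍ " n:arg => EuclideanHalfSpace n

variable {n : ℕ} {M N : Type u} [TopologicalSpace M] [ChartedSpace (ℍ (n + 1)) M]
  [TopologicalSpace N] [ChartedSpace (ℍ (n + 1)) N]
  {bM : BoundaryData (𝓡∂ (n + 1)) M (𝓡 n)} {bN : BoundaryData (𝓡∂ (n + 1)) N (𝓡 n)}
  {φ : bM.carrier ≃ bN.carrier}
  {P : Type w} [TopologicalSpace P] [ChartedSpace (𝔼 (n + 1)) P]

namespace BoundaryGluingData

/-! ### The seam parametrisation `∂M → P` -/

section SeamParam

variable (G : BoundaryGluingData bM bN φ P)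

/-- The **seam parametrisation** `x ↦ jA (incl x) : ∂M → P`. [folklore] -/
def seamMap : bM.carrier → P := G.jA ∘ bM.incl

/-- Unfolding lemma (definitional). [folklore] -/
@[simp] theorem seamMap_apply (x : bM.carrier) : G.seamMap x = G.jA (bM.incl x) := rfl

/-- The seam parametrisation is injective. [folklore] -/
theorem seamMap_injective : Injective G.seamMap := G.injective_jA.comp bM.injective_incl

/-- The seam parametrisation is a topological embedding. [folklore] -/
theorem isEmbedding_seamMap : IsEmbedding G.seamMap :=
  G.isSmoothEmbedding_jA.isEmbedding.comp bM.isSmoothEmbedding.isEmbedding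

/-- The seam parametrisation is smooth. [folklore] -/
theorem contMDiff_seamMap : ContMDiff (𝓡 n) (𝓡 (n + 1)) ∞ G.seamMap :=
  G.contMDiff_jA.comp bM.isSmoothEmbedding.contMDiff

/-- The range of the seam parametrisation is the seam. [folklore] -/
theorem range_seamMap : range G.seamMap = G.seam := rfl

/-- A (total) **left inverse `P → ∂M` of the seam parametrisation** (by `Function.invFun`).
[folklore] -/
def seamInv [Nonempty bM.carrier] : P → bM.carrier := Function.invFun G.seamMap

/-- `seamInv` inverts `seamMap` on the left. [folklore] -/
@[simp] theorem seamInv_seamMap [Nonempty bM.carrier] (x : bM.carrier) :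
    G.seamInv (G.seamMap x) = x :=
  Function.leftInverse_invFun G.seamMap_injective x

/-- `seamInv` inverts `seamMap` on the right on the seam. [folklore] -/
theorem seamMap_seamInv [Nonempty bM.carrier] {p : P} (hp : p ∈ G.seam) :
    G.seamMap (G.seamInv p) = p :=
  Function.invFun_eq hp

/-- `seamInv` is continuous on the seam. [folklore] -/
theorem continuousOn_seamInv [Nonempty bM.carrier] : ContinuousOn G.seamInv G.seam := by
  rw [← range_seamMap, continuousOn_iff_continuous_restrict]
  set e := G.isEmbedding_seamMap.toHomeomorph with he
  have : (range G.seamMap).restrict G.seamInv = e.symm := by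
    funext p
    obtain ⟨a, ha⟩ := e.surjective p
    rw [← ha, Homeomorph.symm_apply_apply]
    exact G.seamInv_seamMap a
  rw [this]
  exact e.symm.continuous

/-- On the seam, `incl ∘ seamInv = jA⁻¹`. [folklore] -/
theorem incl_seamInv [Nonempty bM.carrier] {p : P} (hp : p ∈ G.seam) :
    bM.incl (G.seamInv p) = (haveI : Nonempty M := ⟨bM.incl (Classical.arbitrary _)⟩; G.invA p) := by
  haveI : Nonempty M := ⟨bM.incl (Classical.arbitrary _)⟩
  obtain ⟨x, rfl⟩ := hp
  show bM.incl (G.seamInv (G.seamMap x)) = G.invA (G.jA (bM.incl x))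
  rw [seamInv_seamMap, invA_jA]

variable {EX HX : Type*} [NormedAddCommGroup EX] [NormedSpace ℝ EX] [TopologicalSpace HX]
  {IX : ModelWithCorners ℝ EX HX} {X : Type*} [TopologicalSpace X] [ChartedSpace HX X]

/-- **Maps into `∂M` are smooth when they are continuous and smooth after the seam
parametrisation** (test through the immersions `incl` and `jA`). [folklore] -/
theorem contMDiffWithinAt_of_comp_seamMap [IsManifold (𝓡∂ (n + 1)) ∞ M]
    [IsManifold (𝓡 (n + 1)) ∞ P] {c : X → bM.carrier} {s : Set X} {x : X}
    (hc : ContinuousWithinAt c s x)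
    (h : ContMDiffWithinAt IX (𝓡 (n + 1)) ∞ (G.seamMap ∘ c) s x) :
    ContMDiffWithinAt IX (𝓡 n) ∞ c s x := by
  refine ContMDiffWithinAt.of_comp_isImmersionAt
    (bM.isSmoothEmbedding.isImmersion.isImmersionAt _) hc ?_
  exact G.contMDiffWithinAt_of_comp_jA (bM.continuous_incl.continuousAt.comp_continuousWithinAt hc) h

/-- **A map into the seam, read in `∂M`, is smooth**: if `r : X → P` is `C^∞` within `s` at
`x` with values in the seam, then `seamInv ∘ r` is `C^∞` within `s` at `x`. [folklore] -/
theorem contMDiffWithinAt_seamInv_comp [Nonempty bM.carrier] [IsManifold (𝓡∂ (n + 1)) ∞ M]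
    [IsManifold (𝓡 (n + 1)) ∞ P] {r : X → P} {s : Set X} {x : X}
    (hr : ContMDiffWithinAt IX (𝓡 (n + 1)) ∞ r s x) (hs : MapsTo r s G.seam) (hx : r x ∈ G.seam) :
    ContMDiffWithinAt IX (𝓡 n) ∞ (G.seamInv ∘ r) s x := by
  refine G.contMDiffWithinAt_of_comp_seamMap ?_ ?_
  · exact (G.continuousOn_seamInv _ hx).comp hr.continuousWithinAt hs
  · refine hr.congr (fun y hy => ?_) ?_
    · exact G.seamMap_seamInv (hs hy)
    · exact G.seamMap_seamInv hx

end SeamParam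

/-! ### Seam tubes -/

section Tube

/-- **A seam tube** of the gluing datum `G`: a jointly smooth map `toFun : ∂M × ℝ → P` with
`toFun (x, 0) = jA (incl x)`, a smooth height `height : P → ℝ` and a map `invFun : P → ∂M × ℝ`
inverting `toFun` on `∂M × (-ε, ε) ≅ {|height| < ε}` (a neighbourhood of the seam), with
`invFun` smooth there, `height ∘ toFun = pr₂` on the tube, and such that the height is positive
exactly on `jA (Int M)`, negative exactly on `jB (Int N)` and zero exactly on the seam (so the
upper half tube lies in the first piece and the lower half tube in the second).  This is the
tubular neighbourhood of the seam `V` used in Hirsch's proof of the smoothing theorem (1976,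
Ch. 8, Thm. 1.9) and the embedding `∂M × (-1, 1) → M ∪_φ N` of Bröcker–Jänich (1982), (13.8);
existence for compact Hausdorff pieces is `nonempty_seamTube`. [cite: HirschDT1976, Ch. 8 §1, proof of Thm. 1.9] -/
structure SeamTube (G : BoundaryGluingData bM bN φ P) where
  /-- The tube map `∂M × ℝ → P`. -/
  toFun : bM.carrier × ℝ → P
  /-- The inverse `P → ∂M × ℝ` (meaningful on `{|height| < ε}`). -/
  invFun : P → bM.carrier × ℝ
  /-- The height function of the tube. -/
  height : P → ℝ
  /-- The half-width of the tube. -/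
  ε : ℝ
  /-- The half-width is positive. -/
  ε_pos : 0 < ε
  /-- The tube map is jointly `C^∞` (on all of `∂M × ℝ`). -/
  contMDiff_toFun : ContMDiff ((𝓡 n).prod 𝓘(ℝ, ℝ)) (𝓡 (n + 1)) ∞ toFun
  /-- The height is `C^∞`. -/
  contMDiff_height : ContMDiff (𝓡 (n + 1)) 𝓘(ℝ, ℝ) ∞ height
  /-- The inverse is `C^∞` on `{|height| < ε}`. -/
  contMDiffOn_invFun : ContMDiffOn (𝓡 (n + 1)) ((𝓡 n).prod 𝓘(ℝ, ℝ)) ∞ invFun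
    (height ⁻¹' Ioo (-ε) ε)
  /-- On `∂M × {0}` the tube map is the seam parametrisation. -/
  toFun_zero : ∀ x, toFun (x, 0) = G.jA (bM.incl x)
  /-- The height of the tube map is the tube parameter, for `|t| < ε`. -/
  height_toFun : ∀ x, ∀ t ∈ Ioo (-ε) ε, height (toFun (x, t)) = t
  /-- `invFun` is a left inverse of `toFun` on the tube. -/
  invFun_toFun : ∀ x, ∀ t ∈ Ioo (-ε) ε, invFun (toFun (x, t)) = (x, t)
  /-- `invFun` is a right inverse of `toFun` on `{|height| < ε}`. -/
  toFun_invFun : ∀ p, height p ∈ Ioo (-ε) ε → toFun (invFun p) = p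
  /-- The second component of `invFun` is the height. -/
  invFun_snd : ∀ p, (invFun p).2 = height p
  /-- The height vanishes exactly on the seam. -/
  height_eq_zero_iff : ∀ p, height p = 0 ↔ p ∈ G.seam
  /-- The height is positive exactly on `jA (Int M)`. -/
  height_pos_iff : ∀ p, 0 < height p ↔ p ∈ G.jA '' (𝓡∂ (n + 1)).interior M
  /-- The height is negative exactly on `jB (Int N)`. -/
  height_neg_iff : ∀ p, height p < 0 ↔ p ∈ G.jB '' (𝓡∂ (n + 1)).interior N

namespace SeamTube

variable {G : BoundaryGluingData bM bN φ P} (T : G.SeamTube)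

/-- The tube `{|height| < ε}` is open. [folklore] -/
theorem isOpen_tube : IsOpen (T.height ⁻¹' Ioo (-T.ε) T.ε) :=
  isOpen_Ioo.preimage T.contMDiff_height.continuous

/-- The tube map sends `∂M × (-ε, ε)` into the tube. [folklore] -/
theorem toFun_mem_tube (x : bM.carrier) {t : ℝ} (ht : t ∈ Ioo (-T.ε) T.ε) :
    T.toFun (x, t) ∈ T.height ⁻¹' Ioo (-T.ε) T.ε := by
  rw [mem_preimage, T.height_toFun x t ht]; exact ht

/-- The image of `∂M × (-ε, ε)` is the tube `{|height| < ε}`. [folklore] -/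
theorem image_eq_tube : T.toFun '' (univ ×ˢ Ioo (-T.ε) T.ε) = T.height ⁻¹' Ioo (-T.ε) T.ε := by
  apply Subset.antisymm
  · rintro _ ⟨⟨x, t⟩, ⟨-, ht⟩, rfl⟩
    exact T.toFun_mem_tube x ht
  · intro p hp
    refine ⟨T.invFun p, ⟨mem_univ _, ?_⟩, T.toFun_invFun p hp⟩
    rw [T.invFun_snd]; exact hp

/-- `invFun` maps the tube into `∂M × (-ε, ε)`. [folklore] -/
theorem invFun_mem (p : P) (hp : T.height p ∈ Ioo (-T.ε) T.ε) :
    T.invFun p ∈ (univ : Set bM.carrier) ×ˢ Ioo (-T.ε) T.ε :=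
  ⟨mem_univ _, by rw [T.invFun_snd]; exact hp⟩

/-- Seam points lie in the tube. [folklore] -/
theorem mem_tube_of_mem_seam {p : P} (hp : p ∈ G.seam) : T.height p ∈ Ioo (-T.ε) T.ε := by
  rw [(T.height_eq_zero_iff p).2 hp]; exact ⟨by linarith [T.ε_pos], T.ε_pos⟩

/-- The inverse on the seam: `invFun (jA (incl x)) = (x, 0)`. [folklore] -/
theorem invFun_seamPoint (x : bM.carrier) : T.invFun (G.jA (bM.incl x)) = (x, 0) := by
  rw [← T.toFun_zero x]; exact T.invFun_toFun x 0 ⟨by linarith [T.ε_pos], T.ε_pos⟩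

/-- The height is nonnegative exactly on the first piece. [folklore] -/
theorem height_nonneg_iff (p : P) : 0 ≤ T.height p ↔ p ∈ range G.jA := by
  rw [le_iff_lt_or_eq, T.height_pos_iff, eq_comm, T.height_eq_zero_iff]
  constructor
  · rintro (h | h)
    · exact image_subset_range _ _ h
    · exact G.seam_subset_range_jA h
  · rintro ⟨a, rfl⟩
    by_cases ha : a ∈ (𝓡∂ (n + 1)).interior M
    · exact Or.inl ⟨a, ha, rfl⟩
    · right
      rw [G.jA_mem_seam_iff, bM.range_incl, ← ModelWithCorners.compl_interior]
      exact ha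

/-- The height is nonpositive exactly on the second piece. [folklore] -/
theorem height_nonpos_iff (p : P) : T.height p ≤ 0 ↔ p ∈ range G.jB := by
  rw [le_iff_lt_or_eq, T.height_neg_iff, T.height_eq_zero_iff]
  constructor
  · rintro (h | h)
    · exact image_subset_range _ _ h
    · exact G.seam_subset_range_jB h
  · rintro ⟨b, rfl⟩
    by_cases hb : b ∈ (𝓡∂ (n + 1)).interior N
    · exact Or.inl ⟨b, hb, rfl⟩
    · right
      rw [← G.symm_seam]
      refine (G.symm.jA_mem_seam_iff b).2 ?_
      rw [bN.range_incl, ← ModelWithCorners.compl_interior]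
      exact hb

/-- The upper open half tube lies in `jA (Int M)`. [folklore] -/
theorem toFun_mem_image_interior (x : bM.carrier) {t : ℝ} (ht : t ∈ Ioo 0 T.ε) :
    T.toFun (x, t) ∈ G.jA '' (𝓡∂ (n + 1)).interior M := by
  rw [← T.height_pos_iff, T.height_toFun x t ⟨by linarith [ht.1, T.ε_pos], ht.2⟩]; exact ht.1

/-- The lower open half tube lies in `jB (Int N)`. [folklore] -/
theorem toFun_mem_image_interior' (x : bM.carrier) {t : ℝ} (ht : t ∈ Ioo (-T.ε) 0) :
    T.toFun (x, t) ∈ G.jB '' (𝓡∂ (n + 1)).interior N := by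
  rw [← T.height_neg_iff, T.height_toFun x t ⟨ht.1, by linarith [ht.2, T.ε_pos]⟩]; exact ht.2

/-- The closed upper half tube lies in the first piece. [folklore] -/
theorem toFun_mem_range_jA (x : bM.carrier) {t : ℝ} (ht : t ∈ Ico 0 T.ε) :
    T.toFun (x, t) ∈ range G.jA := by
  rw [← T.height_nonneg_iff, T.height_toFun x t ⟨by linarith [ht.1, T.ε_pos], ht.2⟩]; exact ht.1

/-- The closed lower half tube lies in the second piece. [folklore] -/
theorem toFun_mem_range_jB (x : bM.carrier) {t : ℝ} (ht : t ∈ Ioc (-T.ε) 0) :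
    T.toFun (x, t) ∈ range G.jB := by
  rw [← T.height_nonpos_iff, T.height_toFun x t ⟨ht.1, by linarith [ht.2, T.ε_pos]⟩]; exact ht.2

/-- The tube map is injective on `∂M × (-ε, ε)`. [folklore] -/
theorem injOn_toFun : InjOn T.toFun (univ ×ˢ Ioo (-T.ε) T.ε) := by
  rintro ⟨x, t⟩ ⟨-, ht⟩ ⟨x', t'⟩ ⟨-, ht'⟩ h
  rw [← T.invFun_toFun x t ht, ← T.invFun_toFun x' t' ht', h]

/-- The tube map is smooth at every point, as a map on the product manifold `∂M × ℝ`.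
[folklore] -/
theorem contMDiffAt_toFun (q : bM.carrier × ℝ) :
    ContMDiffAt ((𝓡 n).prod 𝓘(ℝ, ℝ)) (𝓡 (n + 1)) ∞ T.toFun q :=
  T.contMDiff_toFun q

/-- The inverse is smooth at every point of the tube. [folklore] -/
theorem contMDiffAt_invFun {p : P} (hp : T.height p ∈ Ioo (-T.ε) T.ε) :
    ContMDiffAt (𝓡 (n + 1)) ((𝓡 n).prod 𝓘(ℝ, ℝ)) ∞ T.invFun p :=
  (T.contMDiffOn_invFun p hp).contMDiffAt (T.isOpen_tube.mem_nhds hp)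

end SeamTube

end Tube

/-! ### Existence of seam tubes -/

section Existence

variable (G : BoundaryGluingData bM bN φ P) [T2Space M] [T2Space N] [CompactSpace M]
  [CompactSpace N] [IsManifold (𝓡∂ (n + 1)) ∞ M] [IsManifold (𝓡∂ (n + 1)) ∞ N]
  [IsManifold (𝓡 (n + 1)) ∞ P] [Nonempty bM.carrier]

/-- **Seam tubes exist** for gluing data of compact Hausdorff pieces (with nonempty boundary).
Let `f` be a seam height function (`exists_seamFunction_iff`), `ξ` a smooth vector field with
`ξ(f) = 1` on `f⁻¹[-δ, δ]` (`exists_contMDiffSection_mlineDeriv_eq_one_slab`) and `θ` its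
global flow (`exists_contMDiff_globalFlow_of_boundarylessManifold`; `P` is compact, Hausdorff and
without boundary).  The tube is `K (x, t) = θ (t, jA (incl x))` with inverse
`p ↦ (σ (θ (-f p, p)), f p)`, `σ` the inverse of the seam parametrisation: along flow lines `f`
moves at unit speed inside the slab (`UnitSpeed.eq_add_of_deriv_eq_one`), so
`f (K (x, t)) = t` for `|t| < δ` and `θ (-f p, p)` lies on the seam for `|f p| < δ`.  Milnor
(1963), proof of Thm. 3.1; (1965), proof of Thm. 3.4 (`h(y₀, s) = ψ_{y₀}(s)`,
`h⁻¹(y) = (ψ_y(0), f(y))`); Hirsch (1976), Ch. 8 §1, proof of Thm. 1.9 (the tubular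
neighbourhood of `V`). [cite: HirschDT1976, Ch. 8 §1, proof of Thm. 1.9] -/
theorem nonempty_seamTube : Nonempty G.SeamTube := by
  haveI := G.t2Space
  haveI := G.compactSpace
  -- a seam height function
  obtain ⟨f, hf, hf0, hfpos, hfneg, -, -, hreg⟩ := G.exists_seamFunction_iff
  -- a unit-speed field on a slab about the seam, and its global flow
  obtain ⟨ξ, δ, hδ, hξ⟩ := exists_contMDiffSection_mlineDeriv_eq_one_slab (I := 𝓡 (n + 1)) hf
    (a := 0) (b := 0) (fun x hx => hreg x (le_antisymm hx.2 hx.1))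
  obtain ⟨θ, hθ, hθ0, hθadd, hθint⟩ :=
    exists_contMDiff_globalFlow_of_boundarylessManifold (I := 𝓡 (n + 1)) (M := P)
      (V := fun x => ξ x) ξ.contMDiff
  -- unit speed of `f` along the flow lines inside the slab
  have hderiv : ∀ p t, HasDerivAt (fun s => f (θ (s, p)))
      (mlineDeriv (𝓡 (n + 1)) f (θ (t, p)) (ξ (θ (t, p)))) t :=
    fun p t => hasDerivAt_comp_integralCurve hf (hθint p) t
  have hband : ∀ p t, (fun s => f (θ (s, p))) t ∈ Ioo (-δ) δ →
      mlineDeriv (𝓡 (n + 1)) f (θ (t, p)) (ξ (θ (t, p))) = 1 :=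
    fun p t ht => hξ _ ⟨by linarith [ht.1], by linarith [ht.2]⟩
  have hfwd : ∀ p, f p ∈ Ioo (-δ) δ → ∀ s, 0 ≤ s → f p + s < δ → f (θ (s, p)) = f p + s := by
    intro p hp s hs hlt
    have key := UnitSpeed.eq_add_of_deriv_eq_one (hderiv p) (hband p) (t₀ := 0) (T := s)
      (by simpa [hθ0] using hp.1) (by simpa [hθ0] using hlt) s ⟨hs, le_rfl⟩
    simpa [hθ0] using key
  have hbwd : ∀ p, f p ∈ Ioo (-δ) δ → ∀ s, 0 ≤ s → -δ < f p - s → f (θ (-s, p)) = f p - s := by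
    intro p hp s hs hlt
    have hd := fun u => UnitSpeed.hasDerivAt_neg_comp_sub (hderiv p) 0 u
    have hb := UnitSpeed.band_neg_comp_sub (g := fun s => f (θ (s, p))) (hband p) 0
    have key := UnitSpeed.eq_add_of_deriv_eq_one hd hb (t₀ := 0) (T := s)
      (by simpa [hθ0] using hp.2) (by simp only [sub_zero, hθ0]; linarith) s ⟨hs, le_rfl⟩
    simp only [zero_add, zero_sub, sub_zero, hθ0] at key
    linarith
  -- the height along the flow from a seam point, and the retraction onto the seam
  have hseam0 : ∀ x, f (G.seamMap x) = 0 := fun x => (hf0 _).2 (G.jA_incl_mem_seam x)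
  have hflow : ∀ x, ∀ t ∈ Ioo (-δ) δ, f (θ (t, G.seamMap x)) = t := by
    intro x t ht
    have h0 : f (G.seamMap x) ∈ Ioo (-δ) δ := by rw [hseam0]; exact ⟨by linarith, hδ⟩
    rcases le_or_gt 0 t with ht0 | ht0
    · have := hfwd _ h0 t ht0 (by rw [hseam0]; linarith [ht.2])
      rwa [hseam0, zero_add] at this
    · have := hbwd _ h0 (-t) (by linarith) (by rw [hseam0]; linarith [ht.1])
      rw [neg_neg] at this
      rw [this, hseam0]; ring
  have hret : ∀ p, f p ∈ Ioo (-δ) δ → f (θ (-f p, p)) = 0 := by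
    intro p hp
    rcases le_or_gt 0 (f p) with h0 | h0
    · have := hbwd p hp (f p) h0 (by linarith [hp.2])
      rwa [sub_self] at this
    · have := hfwd p hp (-f p) (by linarith) (by linarith [hp.1])
      rwa [add_neg_cancel] at this
  have hretseam : ∀ p, f p ∈ Ioo (-δ) δ → θ (-f p, p) ∈ G.seam := fun p hp =>
    (hf0 _).1 (hret p hp)
  -- the tube map and its inverse
  set K : bM.carrier × ℝ → P := fun q => θ (q.2, G.seamMap q.1) with hK
  set Kinv : P → bM.carrier × ℝ := fun p => (G.seamInv (θ (-f p, p)), f p) with hKinv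
  have hKsm : ContMDiff ((𝓡 n).prod 𝓘(ℝ, ℝ)) (𝓡 (n + 1)) ∞ K :=
    hθ.comp (contMDiff_snd.prodMk (G.contMDiff_seamMap.comp contMDiff_fst))
  have hr : ContMDiff (𝓡 (n + 1)) (𝓡 (n + 1)) ∞ fun p => θ (-f p, p) :=
    hθ.comp ((contDiff_neg.comp_contMDiff hf).prodMk contMDiff_id)
  refine ⟨{ toFun := K
            invFun := Kinv
            height := f
            ε := δ
            ε_pos := hδ
            contMDiff_toFun := hKsm
            contMDiff_height := hf
            contMDiffOn_invFun := ?_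
            toFun_zero := fun x => by simp [hK, hθ0]
            height_toFun := hflow
            invFun_toFun := ?_
            toFun_invFun := ?_
            invFun_snd := fun p => rfl
            height_eq_zero_iff := hf0
            height_pos_iff := hfpos
            height_neg_iff := hfneg }⟩
  · -- smoothness of the inverse on the tube
    intro p hp
    refine ContMDiffWithinAt.prodMk ?_ (hf p).contMDiffWithinAt
    exact G.contMDiffWithinAt_seamInv_comp (hr p).contMDiffWithinAt (fun q hq => hretseam q hq)
      (hretseam p hp)
  · -- left inverse
    intro x t ht
    simp only [hK, hKinv, hflow x t ht, hθadd, neg_add_cancel, hθ0, seamInv_seamMap]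
  · -- right inverse
    intro p hp
    simp only [hK, hKinv]
    rw [G.seamMap_seamInv (hretseam p hp), hθadd, add_neg_cancel, hθ0]

/-- A choice of seam tube. [folklore] -/
def seamTube : G.SeamTube := Classical.choice G.nonempty_seamTube

end Existence

end BoundaryGluingData

end Literature.Topology.FourManifolds
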